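import Summits.BirchSwinnertonDyer.BirchSwinnertonDyer.Theorems.GenusKolyvaginAtTwoGenusPrimitiveSupplyAtTwoArchimedeanKummerCount
import Summits.BirchSwinnertonDyer.BirchSwinnertonDyer.Theorems.GenusKolyvaginAtTwoGenusPrimitiveSupplyAtTwoTwistSelmerTransferUp
import HarnessLib

/-!
# Route `GenusKolyvaginAtTwo`, crux #2 `GenusPrimitiveSupplyAtTwo` (stmt-BirchSwinnertonDyer-22136):
# Mazur–Rubin Cor. 3.4 (i) with an ARCHIMEDEAN `T`-place — DOWN and UP for a congruent pair differing only at an infinite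
# place `w`, modulo Poitou–Tate (real places), Tate's χ and — for UP — the parity of the pair; the transversality at `w` DISPLAYED

Width seat `bsd-line-gk2-p5` g9 (cell `bsd-f1-sign2`, SUPPLY lineage, «UP general-K lane»), file 19 of the series (sequel of
`…ArchimedeanCount.lean` / `…ArchimedeanKummerCount.lean`). THEOREMS ONLY (no definition, no named fact, no `sorry`); helper
`--supports stmt-BirchSwinnertonDyer-22136`; no item is closed; BSD is not proved by any of this.

WHAT. The cell's Δ > 0 supply rows rest on T-A `F1Sign2.AdmissibleTwistSelmerShiftAtTwo` / T-V `StrictShaPropagationAtTwo` (and -desc's T-C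
`EggTwistLawAtTwo`): Mazur–Rubin's Prop. 3.3 / Cor. 3.4 (i) for the twist pair `(E, E^{(d)})`, `d < 0`, whose local Kummer conditions agree at
EVERY finite place and differ only at the REAL place (`F = ℚ(√d)` complex; MR's printed Prop. 3.3 excludes this case by its hypothesis «real
places with `(Δ_E)_v > 0` split»). With the archimedean count `[Sel relaxed at w : Sel strict at w] = #𝓛_w` (part 2,
`GenusKolyArch.relIndex_kummerStrict_kummerRelaxed_singleton_inl_eq_of_facts`) the two transfer theorems of the finite case carry over
VERBATIM to `T = {w}`, `w` infinite — this file, for a congruent pair `Y[p] ≅ E[p]` over any number field: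

* §45 `natCard_selmerGroup_mul_eq_of_transverse_inl_of_localization_ne_zero` (DOWN; companion of g8's p620256 §12): agreement off `w`,
  transversality AT `w` (`𝓐_w ⊓ 𝓚_{E,w} = ⊥`, displayed), `#𝓚_{E,w} = p`, a Selmer class of `E` with `loc_w ≠ 0` ⟹ `#Sel(Y)·p = #Sel(E)`.
* §46 `natCard_selmerGroup_eq_mul_of_transverse_inl_of_forall_localization_eq_zero` (UP; companion of p628794 §32): the same with
  `Sel(E)` STRICT at `w` and the parity of the pair at `S = {w}` (`IsSquare (#Sel(Y)·#Sel(E)·[𝓚_w : 𝓐_w ⊓ 𝓚_w])`, = `kramerParity` at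
  `S = {∞}` for a twist pair with `ρ̄₂` onto) ⟹ `#Sel(Y) = #Sel(E)·p`.
* §47 `natCard_selmerGroup_le_of_agree_of_selmer_eq_bot` — the COUNT-FREE «UP from zero» bound: if `Sel(E) = 0` and `𝓐` agrees with
  `𝓚_E` at every place `≠ w`, then `loc_w` embeds `H¹_𝓐` into `𝓐_w`, so `#Sel(Y) ≤ #𝓐_w` (no duality at all) — with the parity this
  pins `#Sel₂(E^{(d)}) = 2` on the `#Sel₂(E) = 1` rows of T-A.

What is NOT here (the one remaining local input for T-A/T-V/T-C on the habitat): the transversality `𝓐_∞ ⊓ 𝓚_{E,∞} = ⊥` of the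
transported Kummer line of `E^{(d)}` (`d < 0`) and the Kummer line of `E` at the real place when `Δ_E > 0` (Kramer 1981 Prop. 6:
`N E(ℂ) = 2E(ℝ)`, i.e. MR Lemma 2.9 at `v = ∞` gives `H¹_f(E) ∩ H¹_f(E^F) = N E(ℂ)/2E(ℝ) = 0`), and `#𝓚_{E,∞} = [E(ℝ) : 2E(ℝ)] = 2`
(tree `Kramer1981.index_range_two_eq_two_of_Δ_pos`, over `ℝ`; transport to `w.Completion`). References: [MazurRubin2010] Lemma 2.9,
Prop. 3.3, Cor. 3.4 (i); [Kramer1981] Prop. 6, Thm. 1; [MilneADT2006] I Ex. 1.6 (c), Thm. 2.13, Thm. 4.10; [Howard2004HeegnerKolyvagin] Thm. 2.1.11.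
-/

set_option linter.dupNamespace false -- tree convention: `Summit.BirchSwinnertonDyer.BirchSwinnertonDyer.Theorems` (summit = sub-problem)
set_option autoImplicit false

noncomputable section

open scoped Classical ContRepresentation

namespace Summit.BirchSwinnertonDyer.BirchSwinnertonDyer.Theorems.GenusKolyArch

open WeierstrassCurve Field NumberField IsDedekindDomain Function
open Literature.NumberTheory.EllipticCurves Literature.NumberTheory.GaloisRepresentations
open Literature.NumberTheory.GaloisRepresentations.DiscreteGaloisModule (SelmerStructure)
open Literature.NumberTheory.GaloisCohomology
open Summit.BirchSwinnertonDyer.Rank1Residual.X11b.CongruentTransfer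
open Summit.BirchSwinnertonDyer.Rank1Residual.X11b.SelmerCount (card_mul_relIndex_of_le)
open Summit.BirchSwinnertonDyer.Rank1Residual.X11b.KummerPT (kummerStrict kummerRelaxed)
open Summit.BirchSwinnertonDyer.BirchSwinnertonDyer.Theorems.GenusKolyTwistLocal
  (eq_or_eq_of_le_of_le_of_relIndex_prime mem_selmerGroup_kummerStrict_of_forall_localization_eq_zero
    not_isSquare_mul_self_mul_prime)

section Arch

variable {K : Type} [Field K] [NumberField K] (W Y : WeierstrassCurve K) [W.IsElliptic] (p : ℕ) [hp : Fact p.Prime]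

/-! ## §45 DOWN at an infinite place -/

/-- **Mazur–Rubin Cor. 3.4 (i), DOWN, with the `T`-place ARCHIMEDEAN** (`#Sel^{(p)}(Y)·p = #Sel^{(p)}(E)`), for a congruent pair
`Y[p] ≅ E[p]` over a number field `K`. HYPOTHESES: the print facts `poitouTate_selmerStructure_duality_real K` (Milne I 4.10 + Ex. 1.6 (c))
and `localEulerPoincareCharacteristic K_v` (Tate); inverse intertwining `φ, ψ`; the transported structure `𝓐 = φ_*𝓚_Y` (`h𝓐`); an INFINITE
place `w` off which `𝓐` AGREES with `𝓚_E`, at which it is TRANSVERSE (`𝓐_w ⊓ 𝓚_{E,w} = ⊥`), with `#𝓚_{E,w} = p` (`= [E(K_w) : pE(K_w)]`;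
for `p = 2`, `w` real: `Δ_w > 0`), and a Selmer class of `E` with non-zero localisation at `w`. Proof = g8's p620256 §12 verbatim with the
archimedean count `[𝓚^{w} : 𝓚_{w}] = #𝓚_w` (part 2) in place of X11b's finite-place count.
[cite: MazurRubin2010, Prop. 3.3 and Cor. 3.4 (i)] [cite: MilneADT2006, Ch. I, Thm. 2.13 and Thm. 4.10] [cite: Kramer1981, Prop. 6] -/
theorem natCard_selmerGroup_mul_eq_of_transverse_inl_of_localization_ne_zero
    (hPT : poitouTate_selmerStructure_duality_real K)
    (hEP : ∀ v : HeightOneSpectrum (𝓞 K), localEulerPoincareCharacteristic (v.adicCompletion K))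
    (φ : (Y.torsionGaloisModule (p : ℤ)).toContRepresentation →ⁱL
      (W.torsionGaloisModule (p : ℤ)).toContRepresentation)
    (ψ : (W.torsionGaloisModule (p : ℤ)).toContRepresentation →ⁱL
      (Y.torsionGaloisModule (p : ℤ)).toContRepresentation)
    (hψφ : ∀ a, ψ (φ a) = a) (hφψ : ∀ b, φ (ψ b) = b)
    (𝓐 : SelmerStructure (W.torsionGaloisModule (p : ℤ)))
    (h𝓐 : ∀ v, 𝓐 v = (Y.kummerSelmerStructure (p : ℤ) v).map
      (galoisCohomology.map (φ.restrictField (Place.Completion v)) 1))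
    (w : InfinitePlace K)
    (hagree : ∀ v : Place K, v ≠ Sum.inl w → 𝓐 v = W.kummerSelmerStructure (p : ℤ) v)
    (htr : 𝓐 (Sum.inl w) ⊓ W.kummerSelmerStructure (p : ℤ) (Sum.inl w) = ⊥)
    (ht : Nat.card (W.kummerSelmerStructure (p : ℤ) (Sum.inl w)) = p)
    (hns : ∃ c ∈ (W.kummerSelmerStructure (p : ℤ)).selmerGroup,
      galoisCohomology.localization (W.torsionGaloisModule (p : ℤ)) (Sum.inl w) 1 c ≠ 0) :
    Nat.card (Y.selmerGroup (p : ℤ)) * p = Nat.card (W.selmerGroup (p : ℤ)) := by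
  set S : Finset (Place K) := {(Sum.inl w : Place K)} with hS
  have hwS : (Sum.inl w : Place K) ∈ S := by simp [hS]
  have hagreeS : ∀ v ∉ S, 𝓐 v = W.kummerSelmerStructure (p : ℤ) v := fun v hv ↦
    hagree v (by simpa [hS] using hv)
  obtain ⟨hAlo, hAhi⟩ := selmerGroup_sandwich_of_agree W p S hagreeS
  obtain ⟨hKlo, hKhi⟩ := selmerGroup_sandwich_kummer W p S
  have hidx : (kummerStrict W p S).selmerGroup.relIndex (kummerRelaxed W p S).selmerGroup = p := by
    rw [hS, relIndex_kummerStrict_kummerRelaxed_singleton_inl_eq_of_facts W p hp.out.isPrimePow hPT hEP w, ht]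
  obtain ⟨c, hcK, hc⟩ := hns
  have hcns : c ∉ (kummerStrict W p S).selmerGroup :=
    not_mem_selmerGroup_kummerStrict_of_localization_ne_zero W p S hwS hc
  have hK : (W.kummerSelmerStructure (p : ℤ)).selmerGroup = (kummerRelaxed W p S).selmerGroup := by
    rcases eq_or_eq_of_le_of_le_of_relIndex_prime hp.out hKlo hKhi hidx with h | h
    · exact absurd (h ▸ hcK) hcns
    · exact h
  have hA : 𝓐.selmerGroup = (kummerStrict W p S).selmerGroup := by
    rcases eq_or_eq_of_le_of_le_of_relIndex_prime hp.out hAlo hAhi hidx with h | h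
    · exact h
    · exfalso
      have hcA : c ∈ 𝓐.selmerGroup := by rw [h, ← hK]; exact hcK
      have h𝓐v := (SelmerStructure.mem_selmerGroup_iff _ _).mp hcA (Sum.inl w)
      have hKv := (SelmerStructure.mem_selmerGroup_iff _ _).mp hcK (Sum.inl w)
      have hbot : galoisCohomology.localization (W.torsionGaloisModule (p : ℤ)) (Sum.inl w) 1 c ∈
          𝓐 (Sum.inl w) ⊓ W.kummerSelmerStructure (p : ℤ) (Sum.inl w) :=
        AddSubgroup.mem_inf.mpr ⟨h𝓐v, hKv⟩
      rw [htr, AddSubgroup.mem_bot] at hbot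
      exact hc hbot
  have hcount := card_mul_relIndex_of_le (hAlo.trans hAhi)
  rw [hidx, ← hA, ← hK] at hcount
  rw [← natCard_selmerGroup_transport_kummer W Y p φ ψ hψφ hφψ 𝓐 h𝓐,
    selmerGroup_eq_selmerGroup_kummerSelmerStructure]
  exact hcount

/-! ## §46 UP at an infinite place, given the parity of the pair -/

/-- **Mazur–Rubin Cor. 3.4 (i), UP, with the `T`-place ARCHIMEDEAN, given the parity of the pair** (`#Sel^{(p)}(Y) = #Sel^{(p)}(E)·p`):
hypotheses as in §45 but with EVERY Selmer class of `E` having zero localisation at `w` (STRICT) and the parity of the pair at `S = {w}`,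
`IsSquare (#Sel(Y)·#Sel(E)·[𝓚_{E,w} : 𝓐_w ⊓ 𝓚_{E,w}])` (for a twist pair with `ρ̄₂` onto this is `MazurRubin2010.kramerParity` at
`S = {w}`). Proof = p628794 §32 verbatim with the archimedean count.
[cite: MazurRubin2010, Thm. 2.7, Prop. 3.3 and Cor. 3.4 (i)] [cite: MilneADT2006, Ch. I, Thm. 2.13 and Thm. 4.10] [cite: Kramer1981, Prop. 6 and Thm. 1] -/
theorem natCard_selmerGroup_eq_mul_of_transverse_inl_of_forall_localization_eq_zero
    (hPT : poitouTate_selmerStructure_duality_real K)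
    (hEP : ∀ v : HeightOneSpectrum (𝓞 K), localEulerPoincareCharacteristic (v.adicCompletion K))
    (φ : (Y.torsionGaloisModule (p : ℤ)).toContRepresentation →ⁱL
      (W.torsionGaloisModule (p : ℤ)).toContRepresentation)
    (ψ : (W.torsionGaloisModule (p : ℤ)).toContRepresentation →ⁱL
      (Y.torsionGaloisModule (p : ℤ)).toContRepresentation)
    (hψφ : ∀ a, ψ (φ a) = a) (hφψ : ∀ b, φ (ψ b) = b)
    (𝓐 : SelmerStructure (W.torsionGaloisModule (p : ℤ)))
    (h𝓐 : ∀ v, 𝓐 v = (Y.kummerSelmerStructure (p : ℤ) v).map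
      (galoisCohomology.map (φ.restrictField (Place.Completion v)) 1))
    (w : InfinitePlace K)
    (hagree : ∀ v : Place K, v ≠ Sum.inl w → 𝓐 v = W.kummerSelmerStructure (p : ℤ) v)
    (htr : 𝓐 (Sum.inl w) ⊓ W.kummerSelmerStructure (p : ℤ) (Sum.inl w) = ⊥)
    (ht : Nat.card (W.kummerSelmerStructure (p : ℤ) (Sum.inl w)) = p)
    (hstrict : ∀ c ∈ (W.kummerSelmerStructure (p : ℤ)).selmerGroup,
      galoisCohomology.localization (W.torsionGaloisModule (p : ℤ)) (Sum.inl w) 1 c = 0)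
    (hpar : IsSquare (Nat.card (Y.selmerGroup (p : ℤ)) * Nat.card (W.selmerGroup (p : ℤ)) *
      (𝓐 (Sum.inl w)).relIndex (W.kummerSelmerStructure (p : ℤ) (Sum.inl w)))) :
    Nat.card (Y.selmerGroup (p : ℤ)) = Nat.card (W.selmerGroup (p : ℤ)) * p := by
  set S : Finset (Place K) := {(Sum.inl w : Place K)} with hS
  have hagreeS : ∀ v ∉ S, 𝓐 v = W.kummerSelmerStructure (p : ℤ) v := fun v hv ↦
    hagree v (by simpa [hS] using hv)
  obtain ⟨hAlo, hAhi⟩ := selmerGroup_sandwich_of_agree W p S hagreeS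
  obtain ⟨hKlo, hKhi⟩ := selmerGroup_sandwich_kummer W p S
  have hidx : (kummerStrict W p S).selmerGroup.relIndex (kummerRelaxed W p S).selmerGroup = p := by
    rw [hS, relIndex_kummerStrict_kummerRelaxed_singleton_inl_eq_of_facts W p hp.out.isPrimePow hPT hEP w, ht]
  -- `Sel(E)` is the strict group
  have hK : (W.kummerSelmerStructure (p : ℤ)).selmerGroup = (kummerStrict W p S).selmerGroup := by
    refine le_antisymm (fun c hc ↦ ?_) hKlo
    refine mem_selmerGroup_kummerStrict_of_forall_localization_eq_zero W p S hc fun v hv ↦ ?_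
    have hv' : v = Sum.inl w := by simpa [hS] using hv
    subst hv'
    exact hstrict c hc
  -- the local index at `w`
  have hrel : (𝓐 (Sum.inl w)).relIndex (W.kummerSelmerStructure (p : ℤ) (Sum.inl w)) = p := by
    rw [← AddSubgroup.inf_relIndex_right, htr, AddSubgroup.relIndex_bot_left, ht]
  have hAY := natCard_selmerGroup_transport_kummer W Y p φ ψ hψφ hφψ 𝓐 h𝓐
  have hSelW : Nat.card (W.selmerGroup (p : ℤ)) = Nat.card (kummerStrict W p S).selmerGroup := by
    rw [selmerGroup_eq_selmerGroup_kummerSelmerStructure, hK]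
    rfl
  haveI : Finite (W.selmerGroup (p : ℤ)) := W.finite_selmerGroup_holds (Int.natCast_ne_zero.mpr hp.out.ne_zero)
  have hn0 : Nat.card (W.selmerGroup (p : ℤ)) ≠ 0 := Nat.card_pos.ne'
  rw [hrel] at hpar
  rcases eq_or_eq_of_le_of_le_of_relIndex_prime hp.out hAlo hAhi hidx with h | h
  · exfalso
    rw [← hAY, h, ← hSelW] at hpar
    exact not_isSquare_mul_self_mul_prime hp.out hn0 hpar
  · have hcount := card_mul_relIndex_of_le (hKlo.trans hKhi)
    rw [hidx, ← h, hAY, ← hSelW] at hcount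
    exact hcount.symm

/-! ## §47 UP from zero: the count-free embedding `loc_w : H¹_𝓐 ↪ 𝓐_w` when `Sel(E) = 0` -/

omit [W.IsElliptic] hp in
/-- **If `Sel^{(p)}(E)` is TRIVIAL and `𝓐` agrees with `𝓚_E` at every place other than `v₀`, then `#H¹_𝓐 ≤ #𝓐_{v₀}`** — the kernel of
`loc_{v₀}` on `H¹_𝓐` satisfies the Kummer conditions everywhere (the condition at `v₀` trivially), hence lies in `Sel(E) = 0`. No duality.
For `v₀` the real place, `Y = E^{(d)}` with `d < 0`, `Δ_E > 0`, `#Sel₂(E) = 1`: `#Sel₂(E^{(d)}) ≤ #𝓐_∞ = 2` — the upper half of T-A on the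
`Ш(E)[2] = 0` rows; the lower half `≥ 2` is Kramer's parity (transversality at `∞`). [cite: MazurRubin2010, Def. 3.1 and Prop. 3.3]
[cite: Kramer1981, Prop. 6] -/
theorem natCard_selmerGroup_le_of_agree_of_selmer_eq_bot
    (𝓐 : SelmerStructure (W.torsionGaloisModule (p : ℤ))) (v₀ : Place K)
    (hagree : ∀ v : Place K, v ≠ v₀ → 𝓐 v = W.kummerSelmerStructure (p : ℤ) v)
    (hbot : (W.kummerSelmerStructure (p : ℤ)).selmerGroup = ⊥) [Finite (𝓐 v₀)] :
    Nat.card 𝓐.selmerGroup ≤ Nat.card (𝓐 v₀) := by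
  -- `loc_{v₀}` restricted to `H¹_𝓐`, with values in `𝓐_{v₀}`
  let f : 𝓐.selmerGroup → 𝓐 v₀ := fun c ↦
    ⟨galoisCohomology.localization (W.torsionGaloisModule (p : ℤ)) v₀ 1 c,
      (SelmerStructure.mem_selmerGroup_iff _ _).mp c.2 v₀⟩
  have hf : Function.Injective f := by
    intro c c' h
    have hval : galoisCohomology.localization (W.torsionGaloisModule (p : ℤ)) v₀ 1 (c - c' : 𝓐.selmerGroup) = 0 := by
      have := congrArg Subtype.val h
      simp only [f] at this
      rw [AddSubgroup.coe_sub, map_sub, this, sub_self]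
    -- `c - c'` satisfies the Kummer condition everywhere, so lies in `Sel(E) = 0`
    have hmem : ((c - c' : 𝓐.selmerGroup) : galoisCohomology (W.torsionGaloisModule (p : ℤ)) 1) ∈
        (W.kummerSelmerStructure (p : ℤ)).selmerGroup := by
      rw [SelmerStructure.mem_selmerGroup_iff]
      intro v
      by_cases hv : v = v₀
      · subst hv
        rw [hval]
        exact zero_mem _
      · rw [← hagree v hv]
        exact (SelmerStructure.mem_selmerGroup_iff _ _).mp (c - c').2 v
    rw [hbot, AddSubgroup.mem_bot, AddSubgroup.coe_sub, sub_eq_zero] at hmem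
    exact Subtype.ext hmem
  exact Nat.card_le_card_of_injective f hf

end Arch

end Summit.BirchSwinnertonDyer.BirchSwinnertonDyer.Theorems.GenusKolyArch

end
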